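import Summits.HubbardSuperconductivity.HubbardSuperconductivity.Theorems.BalabanIRBirSliceXYOrderRPDomination
import HarnessLib

/-!
# Slice order of the anisotropic XY torus (route BalabanIR, support item `BirSliceXYOrderRP`):
# III. Plane waves and the infrared bound per mode on the product torus

Third file of the proof of
`Summit.HubbardSuperconductivity.HubbardSuperconductivity.Theses.BalabanIR.BirSliceXYOrderRP`.
For the product characters `χ_{k,q}(x,t) = χ_k(x)χ_q(t)` of `(ℤ/L)^d × (ℤ/M)^{d'}` (the tree's
`torusChar` in each factor) we compute `𝓔(f, χ_{k,q}) = 2ε(k,q)∑_p f_p χ_{k,q}(p)` and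
`∑_{{x,y}}|χ(x) - χ(y)|² = 2|Λ|ε(k,q)` with the anisotropic dispersion
`ε(k,q) = ∑ᵢ(1 - cos 2πkᵢ/L) + ∑ⱼ(1 - cos 2πqⱼ/M)`, and deduce from Gaussian domination (file II)
and the tree's second-order inequality `NVector.integral_weight_vecGradForm_sq_le` the infrared
bound per spin component and mode, `4βε(k,q) ∫ w|∑_p ω_p^a χ_{k,q}(p)|² dμ₀ ≤ |Λ| ∫ w dμ₀`
(Friedli–Velenik 2017, Thm. 10.24; Fröhlich–Simon–Spencer 1976, Thm. 3.1), exactly as in the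
tree's cubic `NVector.weighted_mode_bound`.

## References
* S. Friedli, Y. Velenik, *Statistical Mechanics of Lattice Systems*, CUP 2017, §10.5.3, proof of
  Thm. 10.24 (pp. 506–507). [FriedliVelenik2017]
* J. Fröhlich, B. Simon, T. Spencer, Comm. Math. Phys. 50 (1976) 79–95, Thm. 3.1.
  [FrohlichSimonSpencer1976]
-/

noncomputable section

namespace Summit.HubbardSuperconductivity.HubbardSuperconductivity.Theorems

namespace BirSliceXY

open Finset Literature.Probability.LatticeModels

/-! ### Plane waves on the product torus (proof of Thm. 10.24 for `(ℤ/L)^d × (ℤ/M)^{d'}`) -/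

section Shift

open _root_.Complex
open scoped ComplexConjugate

/-- **One lattice direction of `𝓔(f, χ)`**: if `T` is a bijection of the sites with
`χ ∘ T = c·χ`, `|c| = 1`, then `∑_p (f_p - f_{Tp})(χ_p - χ_{Tp}) = (1 - c)(1 - c̄) ∑_p f_p χ_p`
(Friedli–Velenik 2017, proof of Thm. 10.24, the summation by parts
`∑_{{i,j}}(S_i - S_j)(h_i - h_j) = ∑_i S_i(-Δα)_i` one direction at a time). [cite: FriedliVelenik2017, §10.5.3, proof of Thm. 10.24] -/
theorem sum_sub_mul_char_sub {Λ : Type*} [Fintype Λ] (T : Λ → Λ)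
    (hT : ∀ g : Λ → ℂ, ∑ p, g (T p) = ∑ p, g p) (χ : Λ → ℂ) (f : Λ → ℝ) (c : ℂ)
    (hc : conj c * c = 1) (hχ : ∀ p, χ (T p) = χ p * c) :
    ∑ p, (((f p - f (T p) : ℝ)) : ℂ) * (χ p - χ (T p)) =
      (1 - c) * (1 - conj c) * ∑ p, (f p : ℂ) * χ p := by
  set Mf : ℂ := ∑ p, (f p : ℂ) * χ p with hMf
  have hshift : ∑ p, (f (T p) : ℂ) * χ p = conj c * Mf := by
    have h1 : ∑ p, (f (T p) : ℂ) * χ (T p) = Mf := hT (fun p => (f p : ℂ) * χ p)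
    calc ∑ p, (f (T p) : ℂ) * χ p = ∑ p, conj c * ((f (T p) : ℂ) * χ (T p)) := by
          refine Finset.sum_congr rfl fun p _ => ?_
          rw [hχ]
          calc (f (T p) : ℂ) * χ p = (f (T p) : ℂ) * χ p * (conj c * c) := by rw [hc, mul_one]
            _ = conj c * ((f (T p) : ℂ) * (χ p * c)) := by ring
      _ = conj c * Mf := by rw [← Finset.mul_sum, h1]
  have hterm : ∀ p, (((f p - f (T p) : ℝ)) : ℂ) * (χ p - χ (T p)) =
      (1 - c) * ((f p : ℂ) * χ p) - (1 - c) * ((f (T p) : ℂ) * χ p) := by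
    intro p; rw [hχ]; push_cast; ring
  calc ∑ p, (((f p - f (T p) : ℝ)) : ℂ) * (χ p - χ (T p))
      = ∑ p, ((1 - c) * ((f p : ℂ) * χ p) - (1 - c) * ((f (T p) : ℂ) * χ p)) :=
        Finset.sum_congr rfl fun p _ => hterm p
    _ = (1 - c) * Mf - (1 - c) * (conj c * Mf) := by
        rw [Finset.sum_sub_distrib, ← Finset.mul_sum, ← Finset.mul_sum, hshift]
    _ = (1 - c) * (1 - conj c) * Mf := by ring

/-- Re-indexing a sum over a product by a translation of the first factor. [folklore] -/
theorem sum_comp_add_fst {α β : Type*} [Fintype α] [Fintype β] [AddCommGroup α] {A : Type*}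
    [AddCommMonoid A] (a : α) (g : α × β → A) :
    ∑ p : α × β, g (p.1 + a, p.2) = ∑ p, g p := by
  rw [Fintype.sum_prod_type, Fintype.sum_prod_type]
  exact Equiv.sum_comp (Equiv.addRight a) (fun x => ∑ y, g (x, y))

/-- Re-indexing a sum over a product by a translation of the second factor. [folklore] -/
theorem sum_comp_add_snd {α β : Type*} [Fintype α] [Fintype β] [AddCommGroup β] {A : Type*}
    [AddCommMonoid A] (b : β) (g : α × β → A) :
    ∑ p : α × β, g (p.1, p.2 + b) = ∑ p, g p := by
  rw [Fintype.sum_prod_type, Fintype.sum_prod_type]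
  exact Finset.sum_congr rfl fun x _ => Equiv.sum_comp (Equiv.addRight b) (fun y => g (x, y))

/-- `∑ᵢ (1 - e^{ipᵢ})(1 - e^{-ipᵢ}) = 2ε(p)` for the lattice momentum `p = 2πk/L`
(Friedli–Velenik 2017, proof of Thm. 10.24: `2d{1 - (2d)⁻¹∑_{j∼0}cos(p·j)} = 2ε(p)`). [cite: FriedliVelenik2017, §10.5.3, proof of Thm. 10.24] -/
theorem sum_one_sub_exp_mul_conj {d L : ℕ} (k : TorusSite d L) :
    ∑ i : Fin d, (1 - Complex.exp (latticeMomentum L k i * I)) *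
        (1 - conj (Complex.exp (latticeMomentum L k i * I))) =
      ((2 * dispersion (latticeMomentum L k) : ℝ) : ℂ) := by
  unfold dispersion
  push_cast
  rw [Finset.mul_sum]
  refine Finset.sum_congr rfl fun i _ => ?_
  have := one_sub_mul_one_sub_conj_exp (latticeMomentum L k i)
  push_cast at this ⊢
  exact this

/-- `|e^{ipᵢ}| = 1`: `conj(e^{ipᵢ}) e^{ipᵢ} = 1`. [folklore] -/
theorem conj_exp_mul_exp (t : ℝ) : conj (Complex.exp (t * I)) * Complex.exp (t * I) = 1 := by
  rw [mul_comm, Complex.mul_conj]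
  simp [Complex.normSq_eq_norm_sq, Complex.norm_exp_ofReal_mul_I]

end Shift

section PlaneWaves

open _root_.Complex MeasureTheory
open scoped ComplexConjugate

variable {d d' L M : ℕ} [NeZero L] [NeZero M]

/-- **`𝓔(f, χ_{k,q}) = 2(ε(p_k) + ε(p_q)) ∑_p f_p χ_{k,q}(p)`** on the product torus
`(ℤ/L)^d × (ℤ/M)^{d'}` (`L, M ≥ 3`), for a real `f` and the product character
`χ_{k,q}(x,t) = χ_k(x)χ_q(t)` (Friedli–Velenik 2017, proof of Thm. 10.24,
`∑_{{i,j}}(S_i - S_j)(h_i - h_j) = 2ε ∑_i S_i e^{ip·i}`, with the anisotropic dispersion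
`ε(k,q) = ∑ᵢ(1 - cos(2πkᵢ/L)) + ∑ⱼ(1 - cos(2πqⱼ/M))`). [cite: FriedliVelenik2017, §10.5.3, proof of Thm. 10.24] -/
theorem gradFormC_boxChar [DecidableRel (torusGraph d L □ torusGraph d' M).Adj] (hL : 3 ≤ L)
    (hM : 3 ≤ M) (k : TorusSite d L) (q : TorusSite d' M) (f : TorusSite d L × TorusSite d' M → ℝ) :
    gradFormC (torusGraph d L □ torusGraph d' M) f (fun p => torusChar k p.1 * torusChar q p.2) =
      ((2 * (dispersion (latticeMomentum L k) + dispersion (latticeMomentum M q)) : ℝ) : ℂ) *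
        ∑ p, (f p : ℂ) * (torusChar k p.1 * torusChar q p.2) := by
  have hL2 : 2 ≤ L := by omega
  have hM2 : 2 ≤ M := by omega
  set Mf : ℂ := ∑ p : TorusSite d L × TorusSite d' M, (f p : ℂ) * (torusChar k p.1 * torusChar q p.2)
    with hMf
  set u : Fin d → ℂ := fun i => Complex.exp (latticeMomentum L k i * I) with hu
  set v : Fin d' → ℂ := fun j => Complex.exp (latticeMomentum M q j * I) with hv
  have hi : ∀ i : Fin d, ∑ p : TorusSite d L × TorusSite d' M,
      (((f p - f (p.1 + Pi.single i 1, p.2) : ℝ)) : ℂ) *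
        (torusChar k p.1 * torusChar q p.2 - torusChar k (p.1 + Pi.single i 1) * torusChar q p.2) =
      (1 - u i) * (1 - conj (u i)) * Mf := by
    intro i
    have h := sum_sub_mul_char_sub (fun p : TorusSite d L × TorusSite d' M => (p.1 + Pi.single i 1, p.2))
      (sum_comp_add_fst (Pi.single i 1)) (fun p => torusChar k p.1 * torusChar q p.2) f (u i)
      (conj_exp_mul_exp _) (fun p => by
        simp only [torusChar_add_right, torusChar_single hL2 k i, hu]; ring)
    simpa only using h
  have hj : ∀ j : Fin d', ∑ p : TorusSite d L × TorusSite d' M,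
      (((f p - f (p.1, p.2 + Pi.single j 1) : ℝ)) : ℂ) *
        (torusChar k p.1 * torusChar q p.2 - torusChar k p.1 * torusChar q (p.2 + Pi.single j 1)) =
      (1 - v j) * (1 - conj (v j)) * Mf := by
    intro j
    have h := sum_sub_mul_char_sub (fun p : TorusSite d L × TorusSite d' M => (p.1, p.2 + Pi.single j 1))
      (sum_comp_add_snd (Pi.single j 1)) (fun p => torusChar k p.1 * torusChar q p.2) f (v j)
      (conj_exp_mul_exp _) (fun p => by
        simp only [torusChar_add_right, torusChar_single hM2 q j, hv]; ring)
    simpa only using h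
  unfold gradFormC
  rw [sum_edgeFinset_boxTorus hL hM]
  simp only [Sym2.lift_mk]
  have hA : ∑ p : TorusSite d L × TorusSite d' M, ∑ i : Fin d,
      (((f p - f (p.1 + Pi.single i 1, p.2) : ℝ)) : ℂ) *
        (torusChar k p.1 * torusChar q p.2 - torusChar k (p.1 + Pi.single i 1) * torusChar q p.2) =
      ((2 * dispersion (latticeMomentum L k) : ℝ) : ℂ) * Mf := by
    rw [Finset.sum_comm, ← sum_one_sub_exp_mul_conj k, Finset.sum_mul]
    exact Finset.sum_congr rfl fun i _ => hi i
  have hB : ∑ p : TorusSite d L × TorusSite d' M, ∑ j : Fin d',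
      (((f p - f (p.1, p.2 + Pi.single j 1) : ℝ)) : ℂ) *
        (torusChar k p.1 * torusChar q p.2 - torusChar k p.1 * torusChar q (p.2 + Pi.single j 1)) =
      ((2 * dispersion (latticeMomentum M q) : ℝ) : ℂ) * Mf := by
    rw [Finset.sum_comm, ← sum_one_sub_exp_mul_conj q, Finset.sum_mul]
    exact Finset.sum_congr rfl fun j _ => hj j
  rw [Finset.sum_add_distrib, hA, hB]
  push_cast
  ring

/-- `|Λ| = L^d M^{d'}` for the product torus. [folklore] -/
theorem card_boxTorus_real :
    (Fintype.card (TorusSite d L × TorusSite d' M) : ℝ) = (L : ℝ) ^ d * (M : ℝ) ^ d' := by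
  rw [Fintype.card_prod, Nat.cast_mul, NVector.card_torusSite_real, NVector.card_torusSite_real]

/-- **`∑_{{x,y}} ‖χ(x) - χ(y)‖² = 2|Λ|(ε(p_k) + ε(p_q))`** for the product character on the product
torus (`L, M ≥ 3`) (Friedli–Velenik 2017, proof of Thm. 10.24:
`∑_{{i,j}}‖h_i - h_j‖² = 2d|𝕋_L|{1 - (2d)⁻¹∑_{j∼0}cos(p·j)}`). [cite: FriedliVelenik2017, §10.5.3, proof of Thm. 10.24] -/
theorem gradNormSq_boxChar [DecidableRel (torusGraph d L □ torusGraph d' M).Adj] (hL : 3 ≤ L)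
    (hM : 3 ≤ M) (k : TorusSite d L) (q : TorusSite d' M) :
    gradNormSq (torusGraph d L □ torusGraph d' M) (fun p => torusChar k p.1 * torusChar q p.2) =
      2 * (Fintype.card (TorusSite d L × TorusSite d' M) : ℝ) *
        (dispersion (latticeMomentum L k) + dispersion (latticeMomentum M q)) := by
  have hL2 : 2 ≤ L := by omega
  have hM2 : 2 ≤ M := by omega
  unfold gradNormSq
  rw [sum_edgeFinset_boxTorus hL hM]
  simp only [Sym2.lift_mk]
  have hnorm : ∀ p : TorusSite d L × TorusSite d' M, ‖torusChar k p.1 * torusChar q p.2‖ = 1 := by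
    intro p; rw [norm_mul, norm_torusChar, norm_torusChar, mul_one]
  have h1 : ∀ (p : TorusSite d L × TorusSite d' M) (i : Fin d),
      ‖torusChar k p.1 * torusChar q p.2 - torusChar k (p.1 + Pi.single i 1) * torusChar q p.2‖ ^ 2 =
        2 * (1 - Real.cos (latticeMomentum L k i)) := by
    intro p i
    have : torusChar k (p.1 + Pi.single i 1) * torusChar q p.2 =
        torusChar k p.1 * torusChar q p.2 * Complex.exp (latticeMomentum L k i * I) := by
      rw [torusChar_add_right, torusChar_single hL2]; ring
    rw [this, ← mul_one_sub, norm_mul, hnorm, one_mul, ← Complex.normSq_eq_norm_sq,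
      normSq_one_sub_exp_mul_I]
  have h2 : ∀ (p : TorusSite d L × TorusSite d' M) (j : Fin d'),
      ‖torusChar k p.1 * torusChar q p.2 - torusChar k p.1 * torusChar q (p.2 + Pi.single j 1)‖ ^ 2 =
        2 * (1 - Real.cos (latticeMomentum M q j)) := by
    intro p j
    have : torusChar k p.1 * torusChar q (p.2 + Pi.single j 1) =
        torusChar k p.1 * torusChar q p.2 * Complex.exp (latticeMomentum M q j * I) := by
      rw [torusChar_add_right, torusChar_single hM2]; ring
    rw [this, ← mul_one_sub, norm_mul, hnorm, one_mul, ← Complex.normSq_eq_norm_sq,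
      normSq_one_sub_exp_mul_I]
  simp_rw [h1, h2]
  rw [Finset.sum_const, Finset.card_univ, nsmul_eq_mul]
  unfold dispersion
  rw [← Finset.mul_sum, ← Finset.mul_sum]
  ring

variable {ν : ℕ}

/-- **The infrared bound per spin component on the product torus, in weighted form**
(Friedli–Velenik 2017, Thm. 10.24 / Fröhlich–Simon–Spencer 1976 Thm. 3.1, for the anisotropic
torus `(ℤ/L)^d × (ℤ/M)^{d'}`, `L, M ≥ 4` even): with `w(ω) = e^{-β𝓔(ω,ω)}` and the product character
`χ = χ_{k,q}`, `(k,q) ≠ 0`, `4β ε(k,q) ∫ w(ω)|∑_p ω_p^a χ(p)|² dμ₀ ≤ |Λ| ∫ w dμ₀`, from Gaussian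
domination on the product torus (`vZ_le_vZ_zero_boxTorus`) through the tree's second-order
inequality `NVector.integral_weight_vecGradForm_sq_le` applied to the real and imaginary parts of
`χ e_a`. [cite: FriedliVelenik2017, Thm. 10.24, proof pp. 506–507] -/
theorem weighted_mode_bound_box [DecidableRel (torusGraph d L □ torusGraph d' M).Adj]
    (hL : Even L) (hL4 : 4 ≤ L) (hM : Even M) (hM4 : 4 ≤ M) (ρ : Measure (Fin ν → ℝ))
    [IsFiniteMeasure ρ] {K : Set (Fin ν → ℝ)} (hKc : IsCompact K) (hK : ρ Kᶜ = 0) (hρ : ρ ≠ 0)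
    {β : ℝ} (hβ : 0 < β) (k : TorusSite d L) (q : TorusSite d' M)
    (hε : 0 < dispersion (latticeMomentum L k) + dispersion (latticeMomentum M q)) (a : Fin ν) :
    4 * β * (dispersion (latticeMomentum L k) + dispersion (latticeMomentum M q)) *
        ∫ ω, Real.exp (-β * NVector.vecGradForm (torusGraph d L □ torusGraph d' M) ω ω) *
          ‖∑ p, (ω p a : ℂ) * (torusChar k p.1 * torusChar q p.2)‖ ^ 2
            ∂(Measure.pi fun _ : TorusSite d L × TorusSite d' M => ρ) ≤
      (Fintype.card (TorusSite d L × TorusSite d' M) : ℝ) *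
        ∫ ω, Real.exp (-β * NVector.vecGradForm (torusGraph d L □ torusGraph d' M) ω ω)
          ∂(Measure.pi fun _ : TorusSite d L × TorusSite d' M => ρ) := by
  have hL3 : 3 ≤ L := by omega
  have hM3 : 3 ≤ M := by omega
  set ε : ℝ := dispersion (latticeMomentum L k) + dispersion (latticeMomentum M q) with hε'
  set χ : TorusSite d L × TorusSite d' M → ℂ := fun p => torusChar k p.1 * torusChar q p.2 with hχ
  set h₁ : TorusSite d L × TorusSite d' M → Fin ν → ℝ := NVector.planeField a (fun p => (χ p).re)
    with hh₁
  set h₂ : TorusSite d L × TorusSite d' M → Fin ν → ℝ := NVector.planeField a (fun p => (χ p).im)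
    with hh₂
  set w : (TorusSite d L × TorusSite d' M → Fin ν → ℝ) → ℝ := fun ω =>
    Real.exp (-β * NVector.vecGradForm (torusGraph d L □ torusGraph d' M) ω ω) with hw
  set A₁ : (TorusSite d L × TorusSite d' M → Fin ν → ℝ) → ℝ := fun ω =>
    NVector.vecGradForm (torusGraph d L □ torusGraph d' M) ω h₁ with hA₁
  set A₂ : (TorusSite d L × TorusSite d' M → Fin ν → ℝ) → ℝ := fun ω =>
    NVector.vecGradForm (torusGraph d L □ torusGraph d' M) ω h₂ with hA₂
  set Mo : (TorusSite d L × TorusSite d' M → Fin ν → ℝ) → ℂ := fun ω =>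
    ∑ p, (ω p a : ℂ) * χ p with hMo
  set μ₀ : Measure (TorusSite d L × TorusSite d' M → Fin ν → ℝ) :=
    Measure.pi fun _ : TorusSite d L × TorusSite d' M => ρ with hμ₀
  set Z₀ : ℝ := ∫ ω, w ω ∂μ₀ with hZ₀
  set X : ℝ := ∫ ω, w ω * ‖Mo ω‖ ^ 2 ∂μ₀ with hX
  show 4 * β * ε * X ≤ (Fintype.card (TorusSite d L × TorusSite d' M) : ℝ) * Z₀
  have hGD : ∀ (h : TorusSite d L × TorusSite d' M → Fin ν → ℝ) (t : ℝ),
      NVector.vZ (torusGraph d L □ torusGraph d' M) ρ β (t • h) ≤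
        NVector.vZ (torusGraph d L □ torusGraph d' M) ρ β 0 :=
    fun h t => vZ_le_vZ_zero_boxTorus hL hL4 hM hM4 ρ hKc hK hρ hβ.le _
  have key₁ : 2 * β * ∫ ω, w ω * A₁ ω ^ 2 ∂μ₀ ≤
      NVector.vecGradForm (torusGraph d L □ torusGraph d' M) h₁ h₁ * Z₀ :=
    NVector.integral_weight_vecGradForm_sq_le (G := torusGraph d L □ torusGraph d' M) ρ hKc hK hρ hβ
      h₁ (hGD h₁)
  have key₂ : 2 * β * ∫ ω, w ω * A₂ ω ^ 2 ∂μ₀ ≤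
      NVector.vecGradForm (torusGraph d L □ torusGraph d' M) h₂ h₂ * Z₀ :=
    NVector.integral_weight_vecGradForm_sq_le (G := torusGraph d L □ torusGraph d' M) ρ hKc hK hρ hβ
      h₂ (hGD h₂)
  -- `A₁² + A₂² = 4ε²‖Mo‖²`
  have hA : ∀ ω, A₁ ω ^ 2 + A₂ ω ^ 2 = 4 * ε ^ 2 * ‖Mo ω‖ ^ 2 := by
    intro ω
    have hC := gradFormC_boxChar hL3 hM3 k q (fun p => ω p a)
    have hre : A₁ ω = 2 * ε * (Mo ω).re := by
      rw [hA₁, hMo]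
      simp only
      rw [hh₁, NVector.vecGradForm_planeField_right, ← gradFormC_re, hC, Complex.re_ofReal_mul]
    have him : A₂ ω = 2 * ε * (Mo ω).im := by
      rw [hA₂, hMo]
      simp only
      rw [hh₂, NVector.vecGradForm_planeField_right, ← gradFormC_im, hC, Complex.im_ofReal_mul]
    rw [hre, him, ← Complex.normSq_eq_norm_sq, Complex.normSq_apply]
    ring
  -- `B₁ + B₂ = 2|Λ|ε`
  have hB : NVector.vecGradForm (torusGraph d L □ torusGraph d' M) h₁ h₁ +
      NVector.vecGradForm (torusGraph d L □ torusGraph d' M) h₂ h₂ =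
        2 * (Fintype.card (TorusSite d L × TorusSite d' M) : ℝ) * ε := by
    rw [hh₁, hh₂, NVector.vecGradForm_planeField_self, NVector.vecGradForm_planeField_self,
      ← gradNormSq_eq, gradNormSq_boxChar hL3 hM3]
  have hwc : Continuous w :=
    ((NVector.continuous_vecGradForm_self (G := torusGraph d L □ torusGraph d' M)).const_mul (-β)).rexp
  have hA₁c : Continuous A₁ := NVector.continuous_vecGradForm_left (G := torusGraph d L □ torusGraph d' M) h₁
  have hA₂c : Continuous A₂ := NVector.continuous_vecGradForm_left (G := torusGraph d L □ torusGraph d' M) h₂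
  have hMc : Continuous Mo := by rw [hMo]; fun_prop
  have hint : ∀ {f : (TorusSite d L × TorusSite d' M → Fin ν → ℝ) → ℝ}, Continuous f →
      Integrable f μ₀ := fun hf => NVector.integrable_pi_of_continuous ρ hKc hK hf
  have hS : ∫ ω, w ω * A₁ ω ^ 2 ∂μ₀ + ∫ ω, w ω * A₂ ω ^ 2 ∂μ₀ = 4 * ε ^ 2 * X := by
    rw [hX, ← integral_add (hint (by fun_prop)) (hint (by fun_prop)), ← integral_const_mul]
    refine integral_congr_ae (ae_of_all _ fun ω => ?_)
    simp only
    rw [← mul_add, hA ω]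
    ring
  have hsum : 2 * β * (4 * ε ^ 2 * X) ≤
      2 * (Fintype.card (TorusSite d L × TorusSite d' M) : ℝ) * ε * Z₀ := by
    calc 2 * β * (4 * ε ^ 2 * X)
        = 2 * β * ∫ ω, w ω * A₁ ω ^ 2 ∂μ₀ + 2 * β * ∫ ω, w ω * A₂ ω ^ 2 ∂μ₀ := by
          rw [← hS, mul_add]
      _ ≤ NVector.vecGradForm (torusGraph d L □ torusGraph d' M) h₁ h₁ * Z₀ +
            NVector.vecGradForm (torusGraph d L □ torusGraph d' M) h₂ h₂ * Z₀ := add_le_add key₁ key₂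
      _ = 2 * (Fintype.card (TorusSite d L × TorusSite d' M) : ℝ) * ε * Z₀ := by rw [← add_mul, hB]
  have h8 : ε * (4 * β * ε * X) ≤ ε * ((Fintype.card (TorusSite d L × TorusSite d' M) : ℝ) * Z₀) := by
    nlinarith
  exact le_of_mul_le_mul_left h8 hε

end PlaneWaves

end BirSliceXY

end Summit.HubbardSuperconductivity.HubbardSuperconductivity.Theorems
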